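import Mathlib
import Summits.AnomalousDissipation.AnomalousDissipation.Theses.DyadicWallCascade

/-!
# No constant-head and no irrotational half-space hierarchy
# (negative lemmas for the crux `DyadicWallCascade.HalfSpaceHierarchy`, stmt-AnomalousDissipation-18627)

Refuter file, Negative lane (D-0016), route `DyadicWallCascade` of `Summits/AnomalousDissipation`;
cdisprove seat `refuter-cdisprove-stmt-AnomalousDissipation-18627-0`.

The crux asks for a bounded smooth steady Euler flow `(V, Q)` on the open upper half-space, of
degree `0` under `X ↦ 2X`, band-periodic, with zero mass flux and NON-ZERO energy flux
`F = ∫_{[0,1]²} V₃ (‖V‖²/2 + Q)` through the unit square of `{z = 1}`.  Two natural strengthenings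
are refuted here (both are the crux body VERBATIM with one extra clause, so each is literally
`StrategyCensus.Body extra` of `Cruxes/HalfSpaceHierarchy/CensusSignatures.lean`):

* `not_constantHeadHalfSpaceHierarchy` — extra clause: the head (Bernoulli function)
  `‖V‖²/2 + Q` is constant on the half-space.  This is the class of ALL potential flows and ALL
  Beltrami flows (`V × curl V = ∇(‖V‖²/2 + Q) = 0`), i.e. the whole flexible side of 3-D steady
  Euler (contact-topology Beltrami fields, ABC-type flows).  Kill: `F = b · (mass flux) = 0`.
* `not_irrotationalHalfSpaceHierarchy` — extra clause: symmetric velocity gradient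
  `∂ᵢVⱼ = ∂ⱼVᵢ` on the half-space (`curl V = 0`; census strengthening S⁺₁ `IrrotationalHierarchy`).
  Kill WITHOUT analyticity or harmonic-function theory: for a steady Euler flow with symmetric
  gradient `D = DV(X)`, `∇(‖V‖²/2)·h = ⟪V, D h⟫ = ⟪D V, h⟫ = -⟪∇Q, h⟫`, so the head has zero
  derivative (`hasFDerivAt_bernoulli_zero`), is constant on the convex open half-space
  (`IsOpen.is_const_of_fderiv_eq_zero`), and the first lemma applies.

Reading for constructions (binding, not advisory): a witness of the crux has NON-CONSTANT head on
the flux square, hence is vortical with `V × curl V ≢ 0` there; there is no potential or Beltrami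
base flow to perturb from (census T1 (i)), and no Beltrami/contact-topology construction can
produce the object.  Neither dilation invariance nor periodicity nor boundedness is used.
-/

open scoped BigOperators Topology InnerProductSpace
open Filter Set MeasureTheory

-- `Summit.<Summit>.<Problem>` is the tree's mandated summit-side namespace (CONVENTIONS §2); for this
-- single-conjunct summit the two coincide, so the duplicate is deliberate.
set_option linter.dupNamespace false

namespace Summit.AnomalousDissipation.AnomalousDissipation.Theorems

namespace HalfSpaceHierarchyNegative

/-- Coordinates of the image of a vector under a linear map of `ℝ³`, expanded in the standard basis. [folklore] -/
theorem clm_apply_coord (D : (EuclideanSpace ℝ (Fin 3)) →L[ℝ] (EuclideanSpace ℝ (Fin 3))) (a : (EuclideanSpace ℝ (Fin 3))) (k : Fin 3) :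
    (D a) k = ∑ j, a j * (D (EuclideanSpace.single j 1)) k := by
  have hexp : a = ∑ i, a i • EuclideanSpace.single i (1:ℝ) := by
    simpa using ((EuclideanSpace.basisFun (Fin 3) ℝ).sum_repr a).symm
  conv_lhs => rw [hexp]
  simp [map_sum, map_smul, WithLp.ofLp_sum, Finset.sum_apply]

/-- For a linear map of `ℝ³` with SYMMETRIC matrix in the standard basis, `⟪a, D h⟫ = ⟪D a, h⟫`. [folklore] -/
theorem inner_symm_of_symmetric (D : (EuclideanSpace ℝ (Fin 3)) →L[ℝ] (EuclideanSpace ℝ (Fin 3)))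
    (hD : ∀ i j : Fin 3, (D (EuclideanSpace.single i 1)) j = (D (EuclideanSpace.single j 1)) i)
    (a h : (EuclideanSpace ℝ (Fin 3))) : ⟪a, D h⟫_ℝ = ⟪D a, h⟫_ℝ := by
  have h1 : ⟪a, D h⟫_ℝ = ∑ j, a j * (D h) j := by simp [PiLp.inner_apply, mul_comm]
  have h2 : ⟪D a, h⟫_ℝ = ∑ k, (D a) k * h k := by simp [PiLp.inner_apply, mul_comm]
  rw [h1, h2]
  simp_rw [clm_apply_coord D h, clm_apply_coord D a, Finset.mul_sum, Finset.sum_mul]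
  rw [Finset.sum_comm]
  refine Finset.sum_congr rfl fun k _ => Finset.sum_congr rfl fun j _ => ?_
  rw [hD k j]; ring

/-- The Bernoulli function `‖V‖²/2 + Q` of a steady Euler flow with symmetric velocity gradient
(irrotational flow) has zero derivative. [folklore] -/
theorem hasFDerivAt_bernoulli_zero {V : (EuclideanSpace ℝ (Fin 3)) → (EuclideanSpace ℝ (Fin 3))} {Q : (EuclideanSpace ℝ (Fin 3)) → ℝ} {X : (EuclideanSpace ℝ (Fin 3))}
    (hV : DifferentiableAt ℝ V X) (hQ : DifferentiableAt ℝ Q X)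
    (hEul : (fderiv ℝ V X) (V X) + gradient Q X = 0)
    (hsym : ∀ i j : Fin 3, (fderiv ℝ V X (EuclideanSpace.single i 1)) j =
      (fderiv ℝ V X (EuclideanSpace.single j 1)) i) :
    HasFDerivAt (fun Y => ‖V Y‖ ^ 2 / 2 + Q Y) (0 : (EuclideanSpace ℝ (Fin 3)) →L[ℝ] ℝ) X := by
  have hA : HasFDerivAt (fun Y => ‖V Y‖ ^ 2 / 2)
      ((1/2 : ℝ) • (2 • (innerSL ℝ (V X)).comp (fderiv ℝ V X))) X := by
    have h := (hV.hasFDerivAt.norm_sq).const_mul (1/2 : ℝ)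
    refine (h.congr_of_eventuallyEq ?_)
    exact Filter.Eventually.of_forall fun y => by simp [div_eq_inv_mul]
  have hB : HasFDerivAt Q (fderiv ℝ Q X) X := hQ.hasFDerivAt
  have hsum := hA.add hB
  refine hsum.congr_fderiv ?_
  ext h
  have hgrad : fderiv ℝ Q X h = ⟪gradient Q X, h⟫_ℝ := by
    rw [gradient, InnerProductSpace.toDual_symm_apply]
  have hQ' : gradient Q X = -((fderiv ℝ V X) (V X)) := eq_neg_of_add_eq_zero_right hEul
  have e1 : ((1/2 : ℝ) • (2 • (innerSL ℝ (V X)).comp (fderiv ℝ V X)) + fderiv ℝ Q X) h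
      = ⟪V X, fderiv ℝ V X h⟫_ℝ + fderiv ℝ Q X h := by simp
  rw [e1, hgrad, hQ', inner_neg_left, inner_symm_of_symmetric (fderiv ℝ V X) hsym (V X) h]
  simp

/-- If the head `‖V‖²/2 + Q` is constant on the flux square `[0,1]² × {1}` and the mass flux through
it vanishes, then the energy flux through it vanishes. [folklore] -/
theorem energyFlux_eq_zero_of_constHead {V : (EuclideanSpace ℝ (Fin 3)) → (EuclideanSpace ℝ (Fin 3))} {Q : (EuclideanSpace ℝ (Fin 3)) → ℝ} {b : ℝ}
    (hb : ∀ q : ℝ × ℝ, ‖V !₂[q.1, q.2, (1 : ℝ)]‖ ^ 2 / 2 + Q !₂[q.1, q.2, (1 : ℝ)] = b)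
    (hmass : ∫ q in Set.Icc (0 : ℝ) 1 ×ˢ Set.Icc (0 : ℝ) 1, (V !₂[q.1, q.2, (1 : ℝ)]) 2 = 0) :
    (∫ q in Set.Icc (0 : ℝ) 1 ×ˢ Set.Icc (0 : ℝ) 1,
      (V !₂[q.1, q.2, (1 : ℝ)]) 2 * (‖V !₂[q.1, q.2, (1 : ℝ)]‖ ^ 2 / 2 + Q !₂[q.1, q.2, (1 : ℝ)])) = 0 := by
  simp_rw [hb]
  rw [integral_mul_const, hmass, zero_mul]

end HalfSpaceHierarchyNegative

open HalfSpaceHierarchyNegative in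
/-- **No constant-head half-space hierarchy** (refutes the strengthening "crux ∧ the Bernoulli
function `‖V‖²/2 + Q` is constant on the open half-space" of `DyadicWallCascade.HalfSpaceHierarchy`,
stmt-AnomalousDissipation-18627): this is the class of all potential flows AND all Beltrami flows
`curl V = λ V` (for which `∇(‖V‖²/2 + Q) = V × curl V = 0`), in particular every flow produced by the
contact-topology / Beltrami technology.  One line: constant head `b` makes the energy flux through the
unit square of `{z = 1}` equal to `b ·` (mass flux) `= 0`, against `F ≠ 0`. [folklore] -/
theorem not_constantHeadHalfSpaceHierarchy :
    ¬ (∃ (V : EuclideanSpace ℝ (Fin 3) → EuclideanSpace ℝ (Fin 3)) (Q : EuclideanSpace ℝ (Fin 3) → ℝ) (C F : ℝ),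
        (let H : Set (EuclideanSpace ℝ (Fin 3)) := {X | 0 < X 2}
         let e : Fin 3 → EuclideanSpace ℝ (Fin 3) := fun i => EuclideanSpace.single i (1 : ℝ)
         let pt : ℝ × ℝ → EuclideanSpace ℝ (Fin 3) := fun q => !₂[q.1, q.2, (1 : ℝ)]
         ContDiffOn ℝ ((⊤ : ℕ∞) : WithTop ℕ∞) V H ∧ ContDiffOn ℝ ((⊤ : ℕ∞) : WithTop ℕ∞) Q H ∧
         (∀ X ∈ H, ‖V X‖ ≤ C ∧ |Q X| ≤ C) ∧ (∀ X ∈ H, ∑ i : Fin 3, (fderiv ℝ V X (e i)) i = 0) ∧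
         (∀ X ∈ H, (fderiv ℝ V X) (V X) + gradient Q X = 0) ∧
         (∀ X ∈ H, V ((2 : ℝ) • X) = V X ∧ Q ((2 : ℝ) • X) = Q X) ∧
         (∀ X : EuclideanSpace ℝ (Fin 3), 1 ≤ X 2 → X 2 ≤ 2 →
            V (X + e 0) = V X ∧ V (X + e 1) = V X ∧ Q (X + e 0) = Q X ∧ Q (X + e 1) = Q X) ∧
         (∫ q in Set.Icc (0 : ℝ) 1 ×ˢ Set.Icc (0 : ℝ) 1, (V (pt q)) 2 = 0) ∧ F ≠ 0 ∧
         (∫ q in Set.Icc (0 : ℝ) 1 ×ˢ Set.Icc (0 : ℝ) 1, (V (pt q)) 2 * (‖V (pt q)‖ ^ 2 / 2 + Q (pt q)) = F)) ∧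
        (∀ X : EuclideanSpace ℝ (Fin 3), 0 < X 2 → ∀ Y : EuclideanSpace ℝ (Fin 3), 0 < Y 2 →
          ‖V X‖ ^ 2 / 2 + Q X = ‖V Y‖ ^ 2 / 2 + Q Y)) := by
  rintro ⟨V, Q, C, F, hbody, hconst⟩
  simp only at hbody
  obtain ⟨_hVs, _hQs, _hbdd, _hdiv, _hEul, _hdil, _hper, hmass, hF, hflux⟩ := hbody
  have hpt : ∀ q : ℝ × ℝ, (0 : ℝ) < (!₂[q.1, q.2, (1 : ℝ)] : (EuclideanSpace ℝ (Fin 3))) 2 := by intro q; simp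
  have hb : ∀ q : ℝ × ℝ, ‖V !₂[q.1, q.2, (1 : ℝ)]‖ ^ 2 / 2 + Q !₂[q.1, q.2, (1 : ℝ)]
      = ‖V !₂[(0:ℝ), (0:ℝ), (1:ℝ)]‖ ^ 2 / 2 + Q !₂[(0:ℝ), (0:ℝ), (1:ℝ)] :=
    fun q => hconst _ (hpt q) _ (hpt (0, 0))
  rw [energyFlux_eq_zero_of_constHead hb hmass] at hflux
  exact hF hflux.symm

open HalfSpaceHierarchyNegative in
/-- **No irrotational half-space hierarchy** (refutes the natural strengthening S⁺₁ of the crux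
`DyadicWallCascade.HalfSpaceHierarchy`, stmt-AnomalousDissipation-18627: the crux body — verbatim —
together with symmetry of the velocity gradient `∂ᵢVⱼ = ∂ⱼVᵢ` on the open half-space, i.e. `curl V = 0`).
Proof: for an irrotational steady Euler flow the Bernoulli function `B = ‖V‖²/2 + Q` has
`∇B = V × curl V = 0`, so `B` is a constant `b` on the (convex) half-space; then the energy flux through
the unit square of `{z = 1}` is `b · (mass flux) = 0`, contradicting `F ≠ 0`.  No analyticity, no dilation
invariance and no periodicity are used: ANY witness of the crux is vortical on every neighbourhood meeting
the streamlines through the flux square — there is no potential base flow to perturb from. [folklore] -/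
theorem not_irrotationalHalfSpaceHierarchy :
    ¬ (∃ (V : EuclideanSpace ℝ (Fin 3) → EuclideanSpace ℝ (Fin 3)) (Q : EuclideanSpace ℝ (Fin 3) → ℝ) (C F : ℝ),
        (let H : Set (EuclideanSpace ℝ (Fin 3)) := {X | 0 < X 2}
         let e : Fin 3 → EuclideanSpace ℝ (Fin 3) := fun i => EuclideanSpace.single i (1 : ℝ)
         let pt : ℝ × ℝ → EuclideanSpace ℝ (Fin 3) := fun q => !₂[q.1, q.2, (1 : ℝ)]
         ContDiffOn ℝ ((⊤ : ℕ∞) : WithTop ℕ∞) V H ∧ ContDiffOn ℝ ((⊤ : ℕ∞) : WithTop ℕ∞) Q H ∧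
         (∀ X ∈ H, ‖V X‖ ≤ C ∧ |Q X| ≤ C) ∧ (∀ X ∈ H, ∑ i : Fin 3, (fderiv ℝ V X (e i)) i = 0) ∧
         (∀ X ∈ H, (fderiv ℝ V X) (V X) + gradient Q X = 0) ∧
         (∀ X ∈ H, V ((2 : ℝ) • X) = V X ∧ Q ((2 : ℝ) • X) = Q X) ∧
         (∀ X : EuclideanSpace ℝ (Fin 3), 1 ≤ X 2 → X 2 ≤ 2 →
            V (X + e 0) = V X ∧ V (X + e 1) = V X ∧ Q (X + e 0) = Q X ∧ Q (X + e 1) = Q X) ∧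
         (∫ q in Set.Icc (0 : ℝ) 1 ×ˢ Set.Icc (0 : ℝ) 1, (V (pt q)) 2 = 0) ∧ F ≠ 0 ∧
         (∫ q in Set.Icc (0 : ℝ) 1 ×ˢ Set.Icc (0 : ℝ) 1, (V (pt q)) 2 * (‖V (pt q)‖ ^ 2 / 2 + Q (pt q)) = F)) ∧
        (∀ X : EuclideanSpace ℝ (Fin 3), 0 < X 2 → ∀ i j : Fin 3,
          (fderiv ℝ V X (EuclideanSpace.single i (1 : ℝ))) j =
            (fderiv ℝ V X (EuclideanSpace.single j (1 : ℝ))) i)) := by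
  rintro ⟨V, Q, C, F, hbody, hirr⟩
  simp only at hbody
  obtain ⟨hVs, hQs, _hbdd, _hdiv, hEul, _hdil, _hper, hmass, hF, hflux⟩ := hbody
  -- the open half-space is open and convex
  have hHopen : IsOpen {X : EuclideanSpace ℝ (Fin 3) | 0 < X 2} :=
    isOpen_lt continuous_const (PiLp.continuous_apply 2 (fun _ : Fin 3 => ℝ) (2 : Fin 3))
  have hHconv : Convex ℝ {X : EuclideanSpace ℝ (Fin 3) | 0 < X 2} :=
    convex_halfSpace_gt (EuclideanSpace.proj (2 : Fin 3) : (EuclideanSpace ℝ (Fin 3)) →L[ℝ] ℝ).toLinearMap.isLinear (0:ℝ)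
  have hVd : ∀ X : (EuclideanSpace ℝ (Fin 3)), 0 < X 2 → DifferentiableAt ℝ V X := fun X hX =>
    (hVs.differentiableOn (by simp) X hX).differentiableAt (hHopen.mem_nhds hX)
  have hQd : ∀ X : (EuclideanSpace ℝ (Fin 3)), 0 < X 2 → DifferentiableAt ℝ Q X := fun X hX =>
    (hQs.differentiableOn (by simp) X hX).differentiableAt (hHopen.mem_nhds hX)
  -- the Bernoulli function is constant on the half-space
  set B : (EuclideanSpace ℝ (Fin 3)) → ℝ := fun Y => ‖V Y‖ ^ 2 / 2 + Q Y with hBdef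
  have hBder : ∀ X : (EuclideanSpace ℝ (Fin 3)), 0 < X 2 → HasFDerivAt B (0 : (EuclideanSpace ℝ (Fin 3)) →L[ℝ] ℝ) X := fun X hX =>
    hasFDerivAt_bernoulli_zero (hVd X hX) (hQd X hX) (hEul X hX) (hirr X hX)
  have hBdiff : DifferentiableOn ℝ B {X : (EuclideanSpace ℝ (Fin 3)) | 0 < X 2} := fun X hX =>
    (hBder X hX).differentiableAt.differentiableWithinAt
  have hBconst : ∀ {X Y : (EuclideanSpace ℝ (Fin 3))}, X ∈ {X : (EuclideanSpace ℝ (Fin 3)) | 0 < X 2} → Y ∈ {X : (EuclideanSpace ℝ (Fin 3)) | 0 < X 2} → B X = B Y :=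
    fun hX hY => hHopen.is_const_of_fderiv_eq_zero hHconv.isPreconnected hBdiff
      (fun X hX => by simpa using (hBder X hX).fderiv) hX hY
  -- hence constant on the flux square
  have hpt : ∀ q : ℝ × ℝ, (!₂[q.1, q.2, (1 : ℝ)] : (EuclideanSpace ℝ (Fin 3))) ∈ {X : (EuclideanSpace ℝ (Fin 3)) | 0 < X 2} := by
    intro q; simp
  have hb : ∀ q : ℝ × ℝ, ‖V !₂[q.1, q.2, (1 : ℝ)]‖ ^ 2 / 2 + Q !₂[q.1, q.2, (1 : ℝ)]
      = B !₂[(0:ℝ), (0:ℝ), (1:ℝ)] := fun q => hBconst (hpt q) (hpt (0, 0))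
  rw [energyFlux_eq_zero_of_constHead hb hmass] at hflux
  exact hF hflux.symm

end Summit.AnomalousDissipation.AnomalousDissipation.Theorems
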